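import Literature.Analysis.FluidPDE.NSLerayHopf
import HarnessLib

/-!
# Navier–Stokes: weak–strong uniqueness in the Ladyzhenskaya–Prodi–Serrin class — the
  Sather–Serrin reduction

Companion to `Literature/Analysis/FluidPDE/NSLerayHopf.lean`, whose named fact
`Literature.Analysis.FluidPDE.weak_strong_uniqueness` (**ns.S07**; Prodi 1959; Serrin 1963, Thm. 6;
Robinson–Rodrigo–Sadowski 2016, Thm. 8.19) asserts: a Leray–Hopf weak solution `u` of the unforced
system on `ℝ³ × [0, T)` lying in a Serrin class `L^q(0, T; L^r)`, `2/q + 3/r ≤ 1`, `3 < r ≤ ∞`,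
is unique among all Leray–Hopf weak solutions with the same datum (slices compared on `(0, T]`).

This file decomposes the printed proof (Robinson–Rodrigo–Sadowski 2016, proof of Thm. 8.19 =
proof of Thm. 6.10 with Lemma 8.18; Serrin 1963, §§3–4) into named sub-results and **proves the
assembly**: `Literature.Analysis.FluidPDE.weak_strong_uniqueness_of` derives `weak_strong_uniqueness` from

* `Literature.Analysis.FluidPDE.serrin_difference_energy_ineq` — the energy inequality for the difference
  `w = v - u` of the two solutions, RRS (8.12):
  `½‖w(t)‖² + ν ∫₀ᵗ ‖∇w‖² ≤ |∫₀ᵗ ⟨(w·∇)w, u⟩|` (cross-testing the two weak formulations after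
  time mollification, Lemma 8.18, plus the two energy inequalities);
* `Literature.Analysis.FluidPDE.serrin_trilinear_estimate` — the Hölder–interpolation–Sobolev bound of the trilinear
  term, `|⟨(w·∇)w, u⟩| ≤ c ‖u‖_{L^s} ‖w‖₂^{1-3/s} ‖∇w‖₂^{1+3/s}` (RRS, proof of Thm. 8.19);
* `Literature.Analysis.FluidPDE.aemeasurable_lintegral_weakGradient` — measurability in time of the dissipation
  density `t ↦ ‖∇u(t)‖₂²` of an a.e.-in-time weak gradient (folklore glue, see below);

by Young's inequality, absorption of the dissipation, and an integral Gronwall lemma with an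
`L¹` kernel (`Literature.Analysis.FluidPDE.lintegral_gronwall_eq_zero`, proved here; RRS Lemma A.25), exactly as
printed. The three inputs are vendored as named facts (`def … : Prop`) to be discharged
separately; the reduction itself is a real proof.

One level down, `Literature.Analysis.FluidPDE.serrin_trilinear_estimate_of_sobolev` **proves** the trilinear estimate
from the single classical input `Literature.Analysis.FluidPDE.sobolev_L6_of_weakGradient_R3` — the Sobolev inequality
`‖w‖_{L⁶(ℝ³)} ≤ C‖∇w‖_{L²(ℝ³)}` for `w ∈ W^{1,2}` (RRS Thm. 1.7 (i)) — by one four-factor Hölder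
inequality (Mathlib's `ENNReal.lintegral_prod_norm_pow_le`), which performs RRS Thms. 1.4
(three-term Hölder) and 1.5 (Lebesgue interpolation) at once.

## Why the measurability glue

Mathlib's `∫⁻` is a *lower* integral, additive only for (a.e.-)measurable integrands, and the
accepted `Fluid.IsLerayHopfOn` quantifies its weak-gradient witness `G` with no measurability in
time. The printed step "`∫₀ᵀ‖∇w‖² ≤ 2∫₀ᵀ‖∇u‖² + 2∫₀ᵀ‖∇v‖² < ∞`" (needed to absorb the dissipation)
therefore requires that `t ↦ ∫ |G t|²` be a.e.-measurable on `(0, T)`; this holds because weak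
gradients are a.e. unique and `u` is jointly measurable (the true `t ↦ ‖∇u(t)‖₂²` is a countable
supremum of measurable pairings with test fields), and is recorded as the named fact
`Fluid.aemeasurable_lintegral_weakGradient`.

## Design

* All energy bookkeeping of the reduction is done in `ℝ≥0∞` (`Fluid.eEnergy`, lower integrals),
  so that no finiteness is presupposed: the sub-facts are stated in `ℝ≥0∞` form, which the printed
  (finite, real) inequalities imply.
* The Serrin exponents: `θ = 3/s ∈ [0, 1)` enters as `(3 / s).toReal` (`s = ∞` gives `θ = 0`);
  the time exponent is `2/(1-θ) = 2s/(s-3)`.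
* The hypothesis `2/q + 3/r ≤ 1` (rather than `= 1`) of the target is reduced inside the assembly:
  on the bounded interval `(0, T)`, `‖u(t)‖_r^{2r/(r-3)} ≤ 1 + ‖u(t)‖_r^q` pointwise.

## References

* J. Serrin, *The initial value problem for the Navier–Stokes equations*, in: Nonlinear Problems
  (Madison 1962), Univ. Wisconsin Press 1963, 69–98, §§3–4, Thm. 6.
* G. Prodi, *Un teorema di unicità per le equazioni di Navier–Stokes*, Ann. Mat. Pura Appl. 48
  (1959), 173–182.
* J. C. Robinson, J. L. Rodrigo, W. Sadowski, *The three-dimensional Navier–Stokes equations*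
  (CUP 2016), Thms. 1.4, 1.5, 1.7 (pp. 26–28), Thm. 6.10 (pp. 106–107), Lemma 8.16, Thm. 8.17,
  Lemma 8.18, Thm. 8.19 and (8.12) (pp. 130–132), Notes p. 135, Lemma A.25 (p. 282).
* E. Wiedemann, *Weak–strong uniqueness in fluid dynamics* (2018), Thm. 9 and Remark 10.
-/

noncomputable section

open MeasureTheory TopologicalSpace Set Function Filter Topology
open scoped InnerProductSpace RealInnerProductSpace ENNReal NNReal

/-! ### Glue: weak gradients of differences; measurability in time of the dissipation -/

namespace Literature.Analysis.FluidPDE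

section Glue

variable {E : Type*} [NormedAddCommGroup E] [InnerProductSpace ℝ E] [FiniteDimensional ℝ E]
  [MeasurableSpace E] [BorelSpace E]
variable {F' : Type*} [NormedAddCommGroup F'] [InnerProductSpace ℝ F']

/-- Weak gradients on the whole space are linear: if `G₁`, `G₂` are weak gradients of `u₁`, `u₂`
then `G₁ - G₂` is a weak gradient of `u₁ - u₂` (Evans, *PDE*, §5.2.1; test the defining identity
and subtract — every pairing is a genuine integral since test functions have compact support and
the fields are locally integrable). [folklore] -/
theorem HasWeakGradient.sub [CompleteSpace F'] {u₁ u₂ : E → F'} {G₁ G₂ : E → E →L[ℝ] F'}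
    (h₁ : HasWeakGradient u₁ G₁) (h₂ : HasWeakGradient u₂ G₂) :
    HasWeakGradient (u₁ - u₂) (G₁ - G₂) := by
  have hl₁ : LocallyIntegrable u₁ volume := locallyIntegrableOn_univ.1 (by
    simpa only [Opens.coe_top] using h₁.locallyIntegrableOn)
  have hl₂ : LocallyIntegrable u₂ volume := locallyIntegrableOn_univ.1 (by
    simpa only [Opens.coe_top] using h₂.locallyIntegrableOn)
  have hg₁ : LocallyIntegrable G₁ volume := locallyIntegrableOn_univ.1 (by
    simpa only [Opens.coe_top] using h₁.locallyIntegrableOn_deriv)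
  have hg₂ : LocallyIntegrable G₂ volume := locallyIntegrableOn_univ.1 (by
    simpa only [Opens.coe_top] using h₂.locallyIntegrableOn_deriv)
  refine ⟨?_, ?_, fun φ v hφ => ?_⟩
  · simpa only [Opens.coe_top, locallyIntegrableOn_univ] using hl₁.sub hl₂
  · simpa only [Opens.coe_top, locallyIntegrableOn_univ] using hg₁.sub hg₂
  · have hφc : HasCompactSupport φ := hφ.hasCompactSupport
    have hφ1 : ContDiff ℝ 1 φ := hφ.contDiff.of_le (by exact_mod_cast le_top)
    have hdφ : Continuous fun x => fderiv ℝ φ x v :=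
      (hφ1.continuous_fderiv one_ne_zero).clm_apply continuous_const
    have hdφc : HasCompactSupport fun x => fderiv ℝ φ x v := hφc.fderiv_apply (𝕜 := ℝ) v
    have hi₁ : Integrable (fun x => (fderiv ℝ φ x v) • u₁ x) volume :=
      hl₁.integrable_smul_left_of_hasCompactSupport hdφ hdφc
    have hi₂ : Integrable (fun x => (fderiv ℝ φ x v) • u₂ x) volume :=
      hl₂.integrable_smul_left_of_hasCompactSupport hdφ hdφc
    have hj₁ : Integrable (fun x => φ x • G₁ x) volume :=
      hg₁.integrable_smul_left_of_hasCompactSupport hφ.contDiff.continuous hφc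
    have hj₂ : Integrable (fun x => φ x • G₂ x) volume :=
      hg₂.integrable_smul_left_of_hasCompactSupport hφ.contDiff.continuous hφc
    have hk₁ : Integrable (fun x => φ x • G₁ x v) volume := by
      simpa using (ContinuousLinearMap.apply ℝ F' v).integrable_comp hj₁
    have hk₂ : Integrable (fun x => φ x • G₂ x v) volume := by
      simpa using (ContinuousLinearMap.apply ℝ F' v).integrable_comp hj₂
    have e₁ := h₁.integral_fderiv_smul_eq φ v hφ
    have e₂ := h₂.integral_fderiv_smul_eq φ v hφ
    simp only [Opens.coe_top, Measure.restrict_univ] at e₁ e₂ ⊢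
    simp only [Pi.sub_apply, sub_apply, smul_sub]
    rw [integral_sub hi₁ hi₂, integral_sub hk₁ hk₂, e₁, e₂]
    abel

/-- **Measurability in time of the dissipation density of an a.e.-in-time weak gradient**
(folklore; the glue behind "`∫₀ᵀ ‖∇(u - v)‖₂² ≤ 2∫₀ᵀ‖∇u‖₂² + 2∫₀ᵀ‖∇v‖₂²`" in Serrin 1963, §4 and
Robinson–Rodrigo–Sadowski 2016, proof of Thm. 8.19, when — as in the accepted
`Fluid.IsLerayHopfOn` — the gradient witness carries no measurability in time).
Let `u : ℝ → E → E` be jointly a.e.-strongly measurable on `(0, T) × E` and let `G t` be a weak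
gradient of `u t` for a.e. `t ∈ (0, T)`. Then `t ↦ ∫⁻ |G t x|² dx` is a.e.-measurable on `(0, T)`.
(Reason: weak gradients are a.e. unique, `HasWeakFDerivOn.unique`, so for a.e. `t` the slice
integral is `‖∇u(t)‖₂² = sup_Φ (∫ ⟪u t, div Φ⟫)²` over a countable dense family of test fields
`Φ` with `‖Φ‖₂ ≤ 1`, a countable supremum of a.e.-measurable functions of `t`.) [folklore] -/
def aemeasurable_lintegral_weakGradient : Prop :=
  ∀ {T : ℝ} {u : ℝ → E → E} {G : ℝ → E → E →L[ℝ] E}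
    (hu : AEStronglyMeasurable (uncurry u) (volume.restrict (Ioo 0 T ×ˢ univ)))
    (hG : ∀ᵐ t ∂(volume.restrict (Ioo 0 T)), HasWeakGradient (u t) (G t)),
    AEMeasurable (fun t => ∫⁻ x, ENNReal.ofReal (frobeniusNormSq (G t x)))
      (volume.restrict (Ioo 0 T))

end Glue

end Literature.Analysis.FluidPDE

namespace Literature.Analysis.FluidPDE

-- Physical space is written out as `EuclideanSpace ℝ (Fin 3)` (no local notation, to keep the
-- file free of notation declarations); docstrings say `ℝ³`.

/-! ### The two analytic inputs of the Sather–Serrin argument (named facts) -/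

/-- **Energy inequality for the difference of two Leray–Hopf solutions, one in a Serrin class**
(Robinson–Rodrigo–Sadowski 2016, (8.12) in the proof of Thm. 8.19, obtained from Lemma 8.18 —
"a Leray–Hopf weak solution satisfying the Serrin condition can be used as a test function" —
exactly as in the proof of Thm. 6.10; Serrin 1963, §4). Let `ν > 0`, `T > 0`, let `u`, `v` be
Leray–Hopf weak solutions of the unforced system on `ℝ³ × [0, T)` with the same datum `u₀`, and
let `u ∈ L^q(0, T; L^r)`, `2/q + 3/r ≤ 1`, `3 < r ≤ ∞`. Let `G_u`, `G_v` be weak-gradient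
witnesses of `u`, `v` as in the Leray–Hopf clauses (a.e.-in-time weak gradients, square
integrable on `(0, T) × ℝ³`, energy inequality from `s = 0` for every `t ∈ [0, T]`). Then for
every `t ∈ (0, T]`, with `w = v - u`, `∇w = G_v - G_u`,
`‖w(t)‖₂² + 2ν ∫₀ᵗ ‖∇w‖₂² ≤ 2 ∫₀ᵗ ∫ |⟪(w·∇)w, u⟫|`,
stated in `ℝ≥0∞` (`Fluid.eEnergy`, lower integrals; `(w·∇)w = ∇w · w` is `G_w x (w x)`), a form
implied by the printed `½‖w(t)‖² + ν∫₀ᵗ‖∇w‖² ≤ |∫₀ᵗ⟨(w·∇)w, u⟩|` (whose right-hand side is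
finite by Lemma 8.18). Only the energy *inequalities* of `u` and `v` enter (`I₁ ≤ 0`, `I₂ ≤ 0` in
the proof of Thm. 6.10). RRS state Ch. 8 on `𝕋³`/bounded `Ω` (Lemma 8.16: "valid on all domains
considered in this book", incl. `ℝ³` of §4.4/§8.6); the whole space is the original setting of
Prodi 1959 and Serrin 1963 (RRS, Notes p. 135), whose argument is domain-independent. The
witnesses `G_u`, `G_v` are quantified universally: weak gradients are a.e. unique
(`HasWeakFDerivOn.unique`), so every clause is witness-independent up to null sets of times.
[cite: RobinsonRodrigoSadowski2016, (8.12), proof of Thm. 8.19 via Lemma 8.18] -/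
def serrin_difference_energy_ineq : Prop :=
  ∀ {ν T : ℝ} (hν : 0 < ν) (hT : 0 < T) {u₀ : EuclideanSpace ℝ (Fin 3) → EuclideanSpace ℝ (Fin 3)}
    {u v : ℝ → EuclideanSpace ℝ (Fin 3) → EuclideanSpace ℝ (Fin 3)}
    (hu : FluidPDE.IsLerayHopfOn T ν 0 u₀ u) {q r : ℝ≥0∞} (hr : 3 < r) (hqr : 2 / q + 3 / r ≤ 1)
    (hS : FluidPDE.MemLqLp q r u (Ioo 0 T)) (hv : FluidPDE.IsLerayHopfOn T ν 0 u₀ v)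
    (Gu Gv : ℝ → EuclideanSpace ℝ (Fin 3) → EuclideanSpace ℝ (Fin 3) →L[ℝ]
      EuclideanSpace ℝ (Fin 3))
    (hGu : ∀ᵐ t ∂(volume.restrict (Ioo 0 T)), FluidPDE.HasWeakGradient (u t) (Gu t))
    (hGu₂ : ∫⁻ t in Ioo 0 T, ∫⁻ x, ENNReal.ofReal (FluidPDE.frobeniusNormSq (Gu t x)) < ∞)
    (hEu : ∀ t ∈ Icc 0 T, VectorCalculus.kineticEnergy (u t) +
      ν * (∫⁻ τ in Ioo 0 t, ∫⁻ x, ENNReal.ofReal (FluidPDE.frobeniusNormSq (Gu τ x))).toReal ≤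
        VectorCalculus.kineticEnergy u₀)
    (hGv : ∀ᵐ t ∂(volume.restrict (Ioo 0 T)), FluidPDE.HasWeakGradient (v t) (Gv t))
    (hGv₂ : ∫⁻ t in Ioo 0 T, ∫⁻ x, ENNReal.ofReal (FluidPDE.frobeniusNormSq (Gv t x)) < ∞)
    (hEv : ∀ t ∈ Icc 0 T, VectorCalculus.kineticEnergy (v t) +
      ν * (∫⁻ τ in Ioo 0 t, ∫⁻ x, ENNReal.ofReal (FluidPDE.frobeniusNormSq (Gv τ x))).toReal ≤
        VectorCalculus.kineticEnergy u₀),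
    ∀ t ∈ Ioc 0 T,
      FluidPDE.eEnergy (v t - u t) +
          2 * ENNReal.ofReal ν *
            ∫⁻ τ in Ioo 0 t, ∫⁻ x, ENNReal.ofReal (FluidPDE.frobeniusNormSq (Gv τ x - Gu τ x)) ≤
        2 * ∫⁻ τ in Ioo 0 t, ∫⁻ x, ‖⟪(Gv τ x - Gu τ x) (v τ x - u τ x), u τ x⟫‖ₑ

/-- **Serrin's trilinear estimate** (Robinson–Rodrigo–Sadowski 2016, proof of Thm. 8.19, second
display, and proof of Lemma 8.18: three-term Hölder with exponents `(s, 2s/(s-2), 2)`, Lebesgue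
interpolation `‖w‖_{2s/(s-2)} ≤ ‖w‖₂^{1-3/s} ‖w‖₆^{3/s}` and the Sobolev inequality
`‖w‖₆ ≤ c‖∇w‖₂` on `ℝ³`; Serrin 1963, Lemma 1). For every `3 < s ≤ ∞` there is a constant `c`
such that for all `w ∈ L²(ℝ³)` with weak gradient `G`, and all `u ∈ L^s(ℝ³)`,
`∫ |⟪(w·∇)w, u⟫| ≤ c ‖u‖_{L^s} ‖w‖₂^{1-3/s} ‖∇w‖₂^{1+3/s}`,
in `ℝ≥0∞` with `‖w‖₂^{1-3/s} = (∫⁻‖w‖ₑ²)^{(1-θ)/2}`, `‖∇w‖₂^{1+3/s} = (∫⁻ |G|²)^{(1+θ)/2}`,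
`θ = 3/s` (`= 0` for `s = ∞`, the case `‖u‖_∞ ‖w‖₂ ‖∇w‖₂` of Thm. 6.10). [cite: RobinsonRodrigoSadowski2016, proof of Thm. 8.19] -/
def serrin_trilinear_estimate : Prop :=
  ∀ (s : ℝ≥0∞) (hs : 3 < s), ∃ c : ℝ≥0,
    ∀ (w u : EuclideanSpace ℝ (Fin 3) → EuclideanSpace ℝ (Fin 3))
      (G : EuclideanSpace ℝ (Fin 3) → EuclideanSpace ℝ (Fin 3) →L[ℝ] EuclideanSpace ℝ (Fin 3)),
      MemLp w 2 volume → FluidPDE.HasWeakGradient w G →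
      MemLp u s volume →
      ∫⁻ x, ‖⟪G x (w x), u x⟫‖ₑ ≤
        c * eLpNorm u s volume * FluidPDE.eEnergy w ^ ((1 - (3 / s).toReal) / 2) *
          (∫⁻ x, ENNReal.ofReal (FluidPDE.frobeniusNormSq (G x))) ^ ((1 + (3 / s).toReal) / 2)

/-! ### Gronwall's lemma in integral form with an `L¹` kernel, null conclusion -/

/-- **Integral Gronwall lemma with an integrable kernel, homogeneous case**
(Robinson–Rodrigo–Sadowski 2016, Lemma A.25 with `a ≡ 0`: "`η(t) ≤ a(t) + ∫₀ᵗ φ η` ⟹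
`η(t) ≤ a(t) exp ∫₀ᵗ φ`", used at the end of the proofs of Thms. 6.10 and 8.19; there `η` is
continuous, here only bounded). If `φ ≥ 0` is bounded on `(0, T]`, `a ≥ 0` has finite (lower)
integral on `(0, T)`, and `φ(t) ≤ C ∫₀ᵗ a φ` for every `t ∈ (0, T]`, then `φ ≡ 0` on `(0, T]`.
Stated for `ℝ≥0∞`-valued `φ`, `a` and lower integrals, with **no measurability or continuity**
assumed: the proof partitions `(0, T]` into finitely many steps of length `h` on which
`C ∫ a < 1` (absolute continuity of the integral, `exists_pos_setLIntegral_lt_of_measure_lt`) and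
shows inductively that `sup φ` vanishes on each step. [cite: RobinsonRodrigoSadowski2016, Lemma A.25 (case a ≡ 0)] -/
theorem lintegral_gronwall_eq_zero {T : ℝ} {φ a : ℝ → ℝ≥0∞} {C M : ℝ≥0∞} (hC : C ≠ ∞)
    (hM : M ≠ ∞) (hφM : ∀ t ∈ Ioc 0 T, φ t ≤ M) (ha : ∫⁻ t in Ioo 0 T, a t ≠ ∞)
    (hφ : ∀ t ∈ Ioc 0 T, φ t ≤ C * ∫⁻ s in Ioo 0 t, a s * φ s) :
    ∀ t ∈ Ioc 0 T, φ t = 0 := by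
  set μ : Measure ℝ := volume.restrict (Ioo 0 T) with hμ
  -- a threshold `ε` with `C ε < 1`
  set ε : ℝ≥0∞ := (C + 1)⁻¹ with hε
  have hε0 : ε ≠ 0 := ENNReal.inv_ne_zero.2 (by simpa using hC)
  have hCε : C * ε < 1 := by
    refine ENNReal.mul_lt_of_lt_div ?_
    rw [hε, one_div, inv_inv]
    exact ENNReal.lt_add_right hC one_ne_zero
  -- absolute continuity of `∫ a`
  obtain ⟨δ, hδ0, hδ⟩ := exists_pos_setLIntegral_lt_of_measure_lt (μ := μ) ha hε0
  -- a real step `h > 0` with `ofReal h < δ`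
  obtain ⟨h, hh0, hhδ⟩ : ∃ h : ℝ, 0 < h ∧ ENNReal.ofReal h < δ := by
    rcases eq_or_ne δ ∞ with hδ | hδ
    · exact ⟨1, one_pos, by simp [hδ]⟩
    · refine ⟨δ.toReal / 2, half_pos (ENNReal.toReal_pos hδ0.ne' hδ), ?_⟩
      calc ENNReal.ofReal (δ.toReal / 2) < ENNReal.ofReal δ.toReal :=
            (ENNReal.ofReal_lt_ofReal_iff (ENNReal.toReal_pos hδ0.ne' hδ)).2
              (half_lt_self (ENNReal.toReal_pos hδ0.ne' hδ))
        _ = δ := ENNReal.ofReal_toReal hδ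
  -- induction over the steps
  have key : ∀ n : ℕ, ∀ t ∈ Ioc 0 T, t ≤ n * h → φ t = 0 := by
    intro n
    induction n with
    | zero =>
      intro t ht htn
      exact absurd (htn.trans_eq (by simp)) (not_le.2 ht.1)
    | succ n ih =>
      intro t ht htn
      by_cases hle : t ≤ n * h
      · exact ih t ht hle
      push Not at hle
      -- the current step `I = (n h, s'] ∩ …`, `s' = min T ((n+1) h)`
      set s' : ℝ := min T ((n + 1 : ℕ) * h) with hs'
      set I : Set ℝ := Ioc ((n : ℝ) * h) s' with hI
      have hnh : 0 ≤ (n : ℝ) * h := by positivity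
      have htI : t ∈ I := ⟨hle, le_min ht.2 htn⟩
      -- the supremum of `φ` over the step
      set Mk : ℝ≥0∞ := ⨆ (s : ℝ) (_ : s ∈ I), φ s with hMk
      have hIsub : I ⊆ Ioc 0 T := fun s hs => ⟨hnh.trans_lt hs.1, hs.2.trans (min_le_left _ _)⟩
      have hMkM : Mk ≤ M := iSup₂_le fun s hs => hφM s (hIsub hs)
      have hMk_top : Mk ≠ ∞ := ne_top_of_le_ne_top hM hMkM
      -- smallness of `∫ a` over the open step `I' = (n h, s')`
      set I' : Set ℝ := Ioo ((n : ℝ) * h) s' with hI'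
      have hI'sub : I' ⊆ Ioo 0 T := fun s hs =>
        ⟨hnh.trans_lt hs.1, hs.2.trans_le (min_le_left _ _)⟩
      have hI'a : ∫⁻ s in I', a s < ε := by
        have hmeas : μ I' < δ := by
          calc μ I' ≤ volume I' := Measure.restrict_apply_le _ _
            _ = ENNReal.ofReal (s' - n * h) := Real.volume_Ioo
            _ ≤ ENNReal.ofReal h := by
                refine ENNReal.ofReal_le_ofReal ?_
                have : s' ≤ ((n + 1 : ℕ) : ℝ) * h := min_le_right _ _
                push_cast at this
                linarith
            _ < δ := hhδ
        have := hδ I' hmeas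
        rwa [hμ, Measure.restrict_restrict measurableSet_Ioo,
          inter_eq_left.2 hI'sub] at this
      -- the bound `φ s ≤ C ε Mk` on the step
      have hstep : ∀ s ∈ I, φ s ≤ C * ε * Mk := by
        intro s hs
        have hs0T : s ∈ Ioc 0 T := hIsub hs
        calc φ s ≤ C * ∫⁻ τ in Ioo 0 s, a τ * φ τ := hφ s hs0T
          _ = C * ∫⁻ τ in Ioo 0 s, (Ioi ((n : ℝ) * h)).indicator (fun τ => a τ * φ τ) τ := by
              congr 1
              refine setLIntegral_congr_fun measurableSet_Ioo fun τ hτ => ?_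
              by_cases hτn : τ ≤ n * h
              · have : φ τ = 0 := ih τ ⟨hτ.1, hτ.2.le.trans hs0T.2⟩ hτn
                rw [indicator_of_notMem (by simpa using hτn), this, mul_zero]
              · rw [indicator_of_mem (by simpa using hτn)]
          _ = C * ∫⁻ τ in Ioo 0 s ∩ Ioi ((n : ℝ) * h), a τ * φ τ := by
              rw [lintegral_indicator measurableSet_Ioi, Measure.restrict_restrict
                measurableSet_Ioi, inter_comm]
          _ ≤ C * ∫⁻ τ in I', a τ * φ τ := by
              refine mul_le_mul_right (lintegral_mono_set ?_) C
              exact fun τ hτ => ⟨hτ.2, hτ.1.2.trans_le hs.2⟩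
          _ ≤ C * ∫⁻ τ in I', a τ * Mk := by
              gcongr C * ?_
              refine lintegral_mono_ae ((ae_restrict_iff' measurableSet_Ioo).2
                (Eventually.of_forall fun τ hτ => ?_))
              gcongr
              exact le_iSup₂ (f := fun (s : ℝ) (_ : s ∈ I) => φ s) τ ⟨hτ.1, hτ.2.le⟩
          _ = C * ((∫⁻ τ in I', a τ) * Mk) := by rw [lintegral_mul_const' _ _ hMk_top]
          _ ≤ C * (ε * Mk) := by gcongr
          _ = C * ε * Mk := by ring
      -- hence `Mk ≤ C ε Mk`, so `Mk = 0`
      have hMkle : Mk ≤ C * ε * Mk := iSup₂_le hstep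
      have hMk0 : Mk = 0 := by
        by_contra h0
        have : C * ε * Mk < 1 * Mk := ENNReal.mul_lt_mul_left h0 hMk_top hCε
        rw [one_mul] at this
        exact absurd hMkle (not_le.2 this)
      have : φ t ≤ Mk := le_iSup₂ (f := fun (s : ℝ) (_ : s ∈ I) => φ s) t htI
      exact le_antisymm (this.trans_eq hMk0) zero_le
  intro t ht
  refine key ⌈t / h⌉₊ t ht ?_
  calc t = t / h * h := by field_simp
    _ ≤ ⌈t / h⌉₊ * h := by gcongr; exact Nat.le_ceil _

/-! ### Auxiliary inequalities for the assembly -/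

section Aux

variable {E : Type*} [NormedAddCommGroup E] [InnerProductSpace ℝ E] [FiniteDimensional ℝ E]
variable {F' : Type*} [NormedAddCommGroup F'] [InnerProductSpace ℝ F']

omit [InnerProductSpace ℝ F'] in
/-- `‖a - b‖² ≤ 2‖a‖² + 2‖b‖²`, in `ℝ≥0∞`. [folklore] -/
theorem enorm_sub_sq_le (a b : F') : ‖a - b‖ₑ ^ 2 ≤ 2 * ‖a‖ₑ ^ 2 + 2 * ‖b‖ₑ ^ 2 := by
  have h : ‖a - b‖ ^ 2 ≤ 2 * ‖a‖ ^ 2 + 2 * ‖b‖ ^ 2 := by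
    have h1 : ‖a - b‖ ^ 2 ≤ (‖a‖ + ‖b‖) ^ 2 :=
      pow_le_pow_left₀ (norm_nonneg _) (norm_sub_le a b) 2
    nlinarith [sq_nonneg (‖a‖ - ‖b‖)]
  calc ‖a - b‖ₑ ^ 2 = ENNReal.ofReal (‖a - b‖ ^ 2) := by
        rw [ENNReal.ofReal_pow (norm_nonneg _), ofReal_norm]
    _ ≤ ENNReal.ofReal (2 * ‖a‖ ^ 2 + 2 * ‖b‖ ^ 2) := ENNReal.ofReal_le_ofReal h
    _ = 2 * ‖a‖ₑ ^ 2 + 2 * ‖b‖ₑ ^ 2 := by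
        rw [ENNReal.ofReal_add (by positivity) (by positivity), ENNReal.ofReal_mul zero_le_two,
          ENNReal.ofReal_mul zero_le_two, ENNReal.ofReal_pow (norm_nonneg _),
          ENNReal.ofReal_pow (norm_nonneg _), ofReal_norm, ofReal_norm, ENNReal.ofReal_ofNat]

/-- The Frobenius norm squared is subadditive up to the parallelogram factor:
`|A - B|² ≤ 2|A|² + 2|B|²`. [folklore] -/
theorem frobeniusNormSq_sub_le (A B : E →L[ℝ] F') :
    FluidPDE.frobeniusNormSq (A - B) ≤ 2 * FluidPDE.frobeniusNormSq A + 2 * FluidPDE.frobeniusNormSq B := by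
  simp only [FluidPDE.frobeniusNormSq, Finset.mul_sum, ← Finset.sum_add_distrib]
  refine Finset.sum_le_sum fun i _ => ?_
  rw [sub_apply]
  have h1 : ‖A (stdOrthonormalBasis ℝ E i) - B (stdOrthonormalBasis ℝ E i)‖ ^ 2 ≤
      (‖A (stdOrthonormalBasis ℝ E i)‖ + ‖B (stdOrthonormalBasis ℝ E i)‖) ^ 2 :=
    pow_le_pow_left₀ (norm_nonneg _) (norm_sub_le _ _) 2
  nlinarith [sq_nonneg (‖A (stdOrthonormalBasis ℝ E i)‖ - ‖B (stdOrthonormalBasis ℝ E i)‖)]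

/-- The Frobenius norm squared `L ↦ ∑ᵢ ‖L eᵢ‖²` is continuous. [folklore] -/
theorem NSWeakStrongUniqueness.continuous_frobeniusNormSq :
    Continuous (FluidPDE.frobeniusNormSq : (E →L[ℝ] F') → ℝ) := by
  unfold FluidPDE.frobeniusNormSq
  fun_prop

/-- **Young's inequality in the form used to absorb the dissipation** (Robinson–Rodrigo–Sadowski
2016, last display in the proof of Thm. 8.19): for `0 ≤ θ < 1`, `c ≥ 0` and `0 < ν' < ∞` there is
`K < ∞` with `c U a^{(1-θ)/2} b^{(1+θ)/2} ≤ ν' b + K U^{2/(1-θ)} a` for all `U, a, b ∈ [0, ∞]`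
(exponents `2/(1+θ)`, `2/(1-θ)`). [folklore] -/
theorem young_absorb {θ : ℝ} (hθ0 : 0 ≤ θ) (hθ1 : θ < 1) (c : ℝ≥0) {ν' : ℝ≥0∞} (hν0 : ν' ≠ 0)
    (hν : ν' ≠ ∞) :
    ∃ K : ℝ≥0∞, K ≠ ∞ ∧ ∀ U a b : ℝ≥0∞,
      (c : ℝ≥0∞) * U * a ^ ((1 - θ) / 2) * b ^ ((1 + θ) / 2) ≤
        ν' * b + K * U ^ (2 / (1 - θ)) * a := by
  set α : ℝ := (1 - θ) / 2 with hα
  set β : ℝ := (1 + θ) / 2 with hβ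
  have hα0 : 0 < α := by rw [hα]; linarith
  have hβ0 : 0 < β := by rw [hβ]; linarith
  have hβ1 : β < 1 := by rw [hβ]; linarith
  have hαβ : α + β = 1 := by rw [hα, hβ]; ring
  -- conjugate exponents `p = 1/β`, `q = 1/α = 2/(1-θ)`
  have hpq : (1 / β).HolderConjugate (1 / α) := by
    rw [Real.holderConjugate_iff]
    refine ⟨by rw [lt_div_iff₀ hβ0]; linarith, ?_⟩
    rw [one_div, one_div, inv_inv, inv_inv, add_comm, hαβ]
  have hq : 1 / α = 2 / (1 - θ) := by rw [hα]; field_simp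
  refine ⟨(ν'⁻¹) ^ (β * (1 / α)) * (c : ℝ≥0∞) ^ (1 / α), ?_, fun U a b => ?_⟩
  · exact ENNReal.mul_ne_top
      (ENNReal.rpow_lt_top_of_nonneg (by positivity) (ENNReal.inv_ne_top.2 hν0)).ne
      (ENNReal.rpow_lt_top_of_nonneg (by positivity) ENNReal.coe_ne_top).ne
  set X : ℝ≥0∞ := (ν' * b) ^ β with hX
  set Y : ℝ≥0∞ := (ν'⁻¹) ^ β * c * U * a ^ α with hY
  have h1 : ν' ^ β * (ν'⁻¹) ^ β = 1 := by
    rw [← ENNReal.mul_rpow_of_nonneg _ _ hβ0.le, ENNReal.mul_inv_cancel hν0 hν, ENNReal.one_rpow]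
  have hXY : (c : ℝ≥0∞) * U * a ^ α * b ^ β = X * Y := by
    rw [hX, hY, ENNReal.mul_rpow_of_nonneg _ _ hβ0.le]
    calc (c : ℝ≥0∞) * U * a ^ α * b ^ β
        = (ν' ^ β * (ν'⁻¹) ^ β) * ((c : ℝ≥0∞) * U * a ^ α * b ^ β) := by
          rw [h1, one_mul]
      _ = _ := by ring
  have hXp : X ^ (1 / β) = ν' * b := by
    rw [hX, ← ENNReal.rpow_mul, mul_one_div_cancel hβ0.ne', ENNReal.rpow_one]
  have hYq : Y ^ (1 / α) = (ν'⁻¹) ^ (β * (1 / α)) * (c : ℝ≥0∞) ^ (1 / α) * U ^ (1 / α) * a := by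
    rw [hY, ENNReal.mul_rpow_of_nonneg _ _ (by positivity : (0 : ℝ) ≤ 1 / α),
      ENNReal.mul_rpow_of_nonneg _ _ (by positivity : (0 : ℝ) ≤ 1 / α),
      ENNReal.mul_rpow_of_nonneg _ _ (by positivity : (0 : ℝ) ≤ 1 / α), ← ENNReal.rpow_mul,
      ← ENNReal.rpow_mul, mul_one_div_cancel hα0.ne', ENNReal.rpow_one]
  calc (c : ℝ≥0∞) * U * a ^ α * b ^ β = X * Y := hXY
    _ ≤ X ^ (1 / β) / ENNReal.ofReal (1 / β) + Y ^ (1 / α) / ENNReal.ofReal (1 / α) :=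
        ENNReal.young_inequality X Y hpq
    _ ≤ X ^ (1 / β) + Y ^ (1 / α) := by
        gcongr
        · refine ENNReal.div_le_of_le_mul (le_mul_of_one_le_right zero_le ?_)
          rw [← ENNReal.ofReal_one]
          exact ENNReal.ofReal_le_ofReal (by rw [le_div_iff₀ hβ0]; linarith)
        · refine ENNReal.div_le_of_le_mul (le_mul_of_one_le_right zero_le ?_)
          rw [← ENNReal.ofReal_one]
          exact ENNReal.ofReal_le_ofReal (by rw [le_div_iff₀ hα0]; linarith)
    _ = ν' * b + (ν'⁻¹) ^ (β * (1 / α)) * (c : ℝ≥0∞) ^ (1 / α) * U ^ (2 / (1 - θ)) * a := by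
        rw [hXp, hYq, hq]

/-- **Lowering the time exponent on a set of finite measure, without measurability**: if
`u ∈ L^q(S; L^p)` (guarded, `Fluid.MemLqLp`), `|S| < ∞` and `0 ≤ ρ ≤ q`, then
`∫_S ‖u(t)‖_p^ρ dt < ∞` (pointwise `x^ρ ≤ 1 + x^q`; for `q = ∞` the integrand is essentially
bounded). This is the reduction of the Serrin condition `2/q + 3/r ≤ 1` to `2/q' + 3/r = 1`,
`q' = 2r/(r-3) ≤ q`, on a bounded time interval (Robinson–Rodrigo–Sadowski 2016, (8.10)). [folklore] -/
theorem lintegral_rpow_eLpNorm_lt_top {X : Type*} [MeasureSpace X] {F : Type*}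
    [NormedAddCommGroup F] {q p : ℝ≥0∞} {u : ℝ → X → F} {S : Set ℝ} (hS : volume S ≠ ∞)
    (hu : FluidPDE.MemLqLp q p u S) {ρ : ℝ} (hρ0 : 0 ≤ ρ) (hρq : ENNReal.ofReal ρ ≤ q) :
    ∫⁻ t in S, eLpNorm (u t) p volume ^ ρ < ∞ := by
  rcases hρ0.eq_or_lt with rfl | hρ
  · simp only [ENNReal.rpow_zero, setLIntegral_const, one_mul]
    exact hS.lt_top
  · set g : ℝ → ℝ := fun t => (eLpNorm (u t) p volume).toReal with hg
    have hae : ∀ᵐ t ∂(volume.restrict S), eLpNorm (u t) p volume ^ ρ = ‖g t‖ₑ ^ ρ := by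
      filter_upwards [hu.1] with t ht
      rw [hg, Real.enorm_eq_ofReal ENNReal.toReal_nonneg, ENNReal.ofReal_toReal ht.eLpNorm_ne_top]
    rw [lintegral_congr_ae hae]
    have hfin : eLpNorm g q (volume.restrict S) < ∞ := hu.2
    have hq0 : q ≠ 0 := by
      rintro rfl
      exact absurd (nonpos_iff_eq_zero.1 hρq) (by simpa using hρ)
    rcases eq_or_ne q ∞ with rfl | hqtop
    · -- essentially bounded integrand
      rw [eLpNorm_exponent_top] at hfin
      calc ∫⁻ t in S, ‖g t‖ₑ ^ ρ ≤ ∫⁻ _ in S, eLpNormEssSup g (volume.restrict S) ^ ρ := by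
            refine lintegral_mono_ae ?_
            filter_upwards [ae_le_eLpNormEssSup (f := g) (μ := volume.restrict S)] with t ht
            exact ENNReal.rpow_le_rpow ht hρ.le
        _ < ∞ := by
            rw [setLIntegral_const]
            exact ENNReal.mul_lt_top (ENNReal.rpow_lt_top_of_nonneg hρ.le hfin.ne) hS.lt_top
    · have hρq' : ρ ≤ q.toReal := (ENNReal.ofReal_le_iff_le_toReal hqtop).1 hρq
      have hpt : ∀ t, ‖g t‖ₑ ^ ρ ≤ 1 + ‖g t‖ₑ ^ q.toReal := by
        intro t
        rcases le_or_gt (‖g t‖ₑ) 1 with h1 | h1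
        · calc ‖g t‖ₑ ^ ρ ≤ 1 ^ ρ := ENNReal.rpow_le_rpow h1 hρ.le
            _ = 1 := ENNReal.one_rpow _
            _ ≤ 1 + ‖g t‖ₑ ^ q.toReal := le_self_add
        · exact (ENNReal.rpow_le_rpow_of_exponent_le h1.le hρq').trans le_add_self
      calc ∫⁻ t in S, ‖g t‖ₑ ^ ρ
          ≤ ∫⁻ t in S, (1 + ‖g t‖ₑ ^ q.toReal) := lintegral_mono fun t => hpt t
        _ = (∫⁻ _ in S, (1 : ℝ≥0∞)) + ∫⁻ t in S, ‖g t‖ₑ ^ q.toReal :=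
            lintegral_add_left' aemeasurable_const _
        _ < ∞ := by
            rw [setLIntegral_const, one_mul]
            exact ENNReal.add_lt_top.2 ⟨hS.lt_top,
              lintegral_rpow_enorm_lt_top_of_eLpNorm_lt_top hq0 hqtop hfin⟩

end Aux

/-! ### The assembly: `weak_strong_uniqueness` from the named sub-facts -/

/-- **The Sather–Serrin reduction** (Robinson–Rodrigo–Sadowski 2016, proof of Thm. 8.19, which is
the proof of Thm. 6.10 with Lemma 8.18 in place of Lemma 6.6; Serrin 1963, §4). Weak–strong
uniqueness in the Ladyzhenskaya–Prodi–Serrin class, `Literature.Analysis.FluidPDE.weak_strong_uniqueness`, follows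
from the difference energy inequality `serrin_difference_energy_ineq` (RRS (8.12)), the
trilinear estimate `serrin_trilinear_estimate`, and the time-measurability of dissipation
densities `Fluid.aemeasurable_lintegral_weakGradient`, by the printed argument: bound the
trilinear term pointwise in time, apply Young's inequality with the Serrin exponents
(`young_absorb`), absorb `ν∫‖∇w‖²` (finite: `‖∇w‖² ≤ 2‖∇u‖² + 2‖∇v‖²`), and conclude with the
integral Gronwall lemma `lintegral_gronwall_eq_zero` (RRS Lemma A.25) applied to
`t ↦ ‖w(t)‖₂²`, which is bounded by the energy inequalities; the kernel `‖u(t)‖_r^{2r/(r-3)}` is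
integrable on `(0, T)` since `2r/(r-3) ≤ q` (`lintegral_rpow_eLpNorm_lt_top`). Finally
`‖w(t)‖₂ = 0` gives `v(t) = u(t)` a.e. [cite: RobinsonRodrigoSadowski2016, proof of Thm. 8.19] -/
theorem weak_strong_uniqueness_of
    (h0 : FluidPDE.aemeasurable_lintegral_weakGradient (E := EuclideanSpace ℝ (Fin 3)))
    (h1 : serrin_difference_energy_ineq) (h2 : serrin_trilinear_estimate) :
    weak_strong_uniqueness := by
  intro ν T hν hT u₀ u v hu q r hr hqr hS hv
  -- ### exponents: `θ = 3/r ∈ [0,1)`, time exponent `ρ = 2/(1-θ) ≤ q`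
  have hr0 : r ≠ 0 := by rintro rfl; simp at hr
  have h3r : (3 : ℝ≥0∞) / r < 1 :=
    (ENNReal.div_lt_iff (Or.inl hr0) (Or.inr (ENNReal.ofNat_ne_top (n := 3)))).2
      (by simpa using hr)
  have h3r_top : (3 : ℝ≥0∞) / r ≠ ∞ := (h3r.trans ENNReal.one_lt_top).ne
  set θ : ℝ := ((3 : ℝ≥0∞) / r).toReal with hθ
  have hθ0 : 0 ≤ θ := ENNReal.toReal_nonneg
  have hθ1 : θ < 1 := by
    have h := (ENNReal.toReal_lt_toReal h3r_top ENNReal.one_ne_top).2 h3r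
    rw [ENNReal.toReal_one] at h
    exact h
  set ρ : ℝ := 2 / (1 - θ) with hρ
  have hρ0 : 0 ≤ ρ := by rw [hρ]; exact div_nonneg zero_le_two (by linarith)
  have hρq : ENNReal.ofReal ρ ≤ q := by
    rcases eq_or_ne q ∞ with rfl | hqtop
    · exact le_top
    have h2q : 2 / q ≤ ENNReal.ofReal (1 - θ) := by
      have := ENNReal.le_sub_of_add_le_right h3r_top hqr
      rwa [← ENNReal.ofReal_toReal h3r_top, ← hθ, ← ENNReal.ofReal_one,
        ← ENNReal.ofReal_sub _ hθ0] at this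
    have hq0 : q ≠ 0 := by
      rintro rfl
      rw [ENNReal.div_zero two_ne_zero] at h2q
      exact absurd h2q (not_le.2 ENNReal.ofReal_lt_top)
    rw [ENNReal.div_le_iff hq0 hqtop] at h2q
    have h2q' : (2 : ℝ) ≤ (1 - θ) * q.toReal := by
      have := ENNReal.toReal_mono (ENNReal.mul_ne_top ENNReal.ofReal_ne_top hqtop) h2q
      rwa [ENNReal.toReal_mul, ENNReal.toReal_ofReal (by linarith), ENNReal.toReal_ofNat] at this
    refine ENNReal.ofReal_le_of_le_toReal ?_
    rw [hρ, div_le_iff₀ (by linarith)]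
    linarith
  -- ### the weak-gradient witnesses of `u` and `v`
  obtain ⟨Gu, hGu, hGu₂, hEu', -⟩ := hu.weakGrad_energy
  obtain ⟨Gv, hGv, hGv₂, hEv', -⟩ := hv.weakGrad_energy
  have hEu : ∀ t ∈ Icc 0 T, VectorCalculus.kineticEnergy (u t) +
      ν * (∫⁻ τ in Ioo 0 t, ∫⁻ x, ENNReal.ofReal (FluidPDE.frobeniusNormSq (Gu τ x))).toReal ≤
        VectorCalculus.kineticEnergy u₀ := fun t ht => by simpa using hEu' t ht
  have hEv : ∀ t ∈ Icc 0 T, VectorCalculus.kineticEnergy (v t) +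
      ν * (∫⁻ τ in Ioo 0 t, ∫⁻ x, ENNReal.ofReal (FluidPDE.frobeniusNormSq (Gv τ x))).toReal ≤
        VectorCalculus.kineticEnergy u₀ := fun t ht => by simpa using hEv' t ht
  -- ### notation
  set w : ℝ → EuclideanSpace ℝ (Fin 3) → EuclideanSpace ℝ (Fin 3) := fun t => v t - u t with hw
  set Gw : ℝ → EuclideanSpace ℝ (Fin 3) → EuclideanSpace ℝ (Fin 3) →L[ℝ]
      EuclideanSpace ℝ (Fin 3) := fun t => Gv t - Gu t with hGw_def
  set Φ : ℝ → ℝ≥0∞ := fun t => FluidPDE.eEnergy (w t) with hΦ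
  set Ψ : ℝ → ℝ≥0∞ := fun t => ∫⁻ x, ENNReal.ofReal (FluidPDE.frobeniusNormSq (Gw t x)) with hΨ
  set Ψu : ℝ → ℝ≥0∞ := fun t => ∫⁻ x, ENNReal.ofReal (FluidPDE.frobeniusNormSq (Gu t x)) with hΨu
  set Ψv : ℝ → ℝ≥0∞ := fun t => ∫⁻ x, ENNReal.ofReal (FluidPDE.frobeniusNormSq (Gv t x)) with hΨv
  set A : ℝ → ℝ≥0∞ := fun t => eLpNorm (u t) r volume ^ ρ with hA
  set L : ℝ → ℝ≥0∞ := fun t => ∫⁻ x, ‖⟪Gw t x (w t x), u t x⟫‖ₑ with hL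
  -- ### the difference: slices in `L²`, a.e. weak gradient, measurable dissipation
  have hwL2 : ∀ t ∈ Icc 0 T, MemLp (w t) 2 volume := fun t ht =>
    (hv.memLp t ht).sub (hu.memLp t ht)
  have hGw : ∀ᵐ t ∂(volume.restrict (Ioo 0 T)), FluidPDE.HasWeakGradient (w t) (Gw t) := by
    filter_upwards [hGu, hGv] with t h₁ h₂
    exact h₂.sub h₁
  have hw_meas : AEStronglyMeasurable (uncurry w) (volume.restrict (Ioo 0 T ×ˢ univ)) := by
    have : uncurry w = uncurry v - uncurry u := rfl
    rw [this]
    exact hv.weak.1.sub hu.weak.1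
  have hΨ_meas : AEMeasurable Ψ (volume.restrict (Ioo 0 T)) := h0 hw_meas hGw
  have hΨu_meas : AEMeasurable Ψu (volume.restrict (Ioo 0 T)) := h0 hu.weak.1 hGu
  have hΨv_meas : AEMeasurable Ψv (volume.restrict (Ioo 0 T)) := h0 hv.weak.1 hGv
  -- `‖∇w‖² ≤ 2‖∇v‖² + 2‖∇u‖²` for a.e. time, hence `∫₀ᵀ ‖∇w‖² < ∞`
  have hΨ_le : ∀ᵐ t ∂(volume.restrict (Ioo 0 T)), Ψ t ≤ 2 * Ψv t + 2 * Ψu t := by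
    filter_upwards [hGv] with t hv'
    have hmv : AEMeasurable (fun x => ENNReal.ofReal (FluidPDE.frobeniusNormSq (Gv t x))) volume := by
      have hli : LocallyIntegrable (Gv t) volume := locallyIntegrableOn_univ.1 (by
        simpa only [Opens.coe_top] using hv'.locallyIntegrableOn_deriv)
      exact ENNReal.measurable_ofReal.comp_aemeasurable
        (NSWeakStrongUniqueness.continuous_frobeniusNormSq.comp_aestronglyMeasurable hli.aestronglyMeasurable).aemeasurable
    calc Ψ t ≤ ∫⁻ x, (2 * ENNReal.ofReal (FluidPDE.frobeniusNormSq (Gv t x)) +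
          2 * ENNReal.ofReal (FluidPDE.frobeniusNormSq (Gu t x))) := by
          refine lintegral_mono fun x => ?_
          calc ENNReal.ofReal (FluidPDE.frobeniusNormSq (Gw t x))
              ≤ ENNReal.ofReal (2 * FluidPDE.frobeniusNormSq (Gv t x) +
                  2 * FluidPDE.frobeniusNormSq (Gu t x)) :=
                ENNReal.ofReal_le_ofReal (frobeniusNormSq_sub_le _ _)
            _ = _ := by
                rw [ENNReal.ofReal_add (by positivity [FluidPDE.frobeniusNormSq_nonneg (Gv t x)])
                  (by positivity [FluidPDE.frobeniusNormSq_nonneg (Gu t x)]),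
                  ENNReal.ofReal_mul zero_le_two, ENNReal.ofReal_mul zero_le_two,
                  ENNReal.ofReal_ofNat]
      _ = 2 * Ψv t + 2 * Ψu t := by
          rw [lintegral_add_left' (hmv.const_mul _), lintegral_const_mul' _ _ ENNReal.ofNat_ne_top,
            lintegral_const_mul' _ _ ENNReal.ofNat_ne_top]
  have hΨT : ∫⁻ t in Ioo 0 T, Ψ t < ∞ := by
    calc ∫⁻ t in Ioo 0 T, Ψ t ≤ ∫⁻ t in Ioo 0 T, (2 * Ψv t + 2 * Ψu t) := lintegral_mono_ae hΨ_le
      _ = (2 * ∫⁻ t in Ioo 0 T, Ψv t) + 2 * ∫⁻ t in Ioo 0 T, Ψu t := by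
          rw [lintegral_add_left' (hΨv_meas.const_mul _),
            lintegral_const_mul' _ _ ENNReal.ofNat_ne_top,
            lintegral_const_mul' _ _ ENNReal.ofNat_ne_top]
      _ < ∞ := ENNReal.add_lt_top.2
          ⟨ENNReal.mul_lt_top ENNReal.ofNat_lt_top hGv₂,
            ENNReal.mul_lt_top ENNReal.ofNat_lt_top hGu₂⟩
  -- ### (8.12): the difference energy inequality
  have H1 := h1 hν hT hu hr hqr hS hv Gu Gv hGu hGu₂ hEu hGv hGv₂ hEv
  -- ### the trilinear estimate and Young: pointwise-in-time bound
  obtain ⟨c, hc⟩ := h2 r hr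
  obtain ⟨K, hK, hY⟩ := young_absorb hθ0 hθ1 c (ν' := ENNReal.ofReal ν)
    (by simpa using hν) ENNReal.ofReal_ne_top
  have hLbd : ∀ᵐ τ ∂(volume.restrict (Ioo 0 T)),
      L τ ≤ ENNReal.ofReal ν * Ψ τ + K * (A τ * Φ τ) := by
    filter_upwards [hGw, hS.1, ae_restrict_mem measurableSet_Ioo] with τ hG hSτ hτ
    have := hc (w τ) (u τ) (Gw τ) (hwL2 τ ⟨hτ.1.le, hτ.2.le⟩) hG hSτ
    refine this.trans ?_
    have hy := hY (eLpNorm (u τ) r volume) (Φ τ) (Ψ τ)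
    rw [mul_assoc K]  at hy
    simpa only [hA, hρ, mul_assoc] using hy
  -- ### absorption: `‖w(t)‖² ≤ 2K ∫₀ᵗ ‖u‖_r^ρ ‖w‖²`
  have hmain : ∀ t ∈ Ioc 0 T, Φ t ≤ 2 * K * ∫⁻ τ in Ioo 0 t, A τ * Φ τ := by
    intro t ht
    have hsub : Ioo 0 t ⊆ Ioo 0 T := Ioo_subset_Ioo le_rfl ht.2
    have hΨt_meas : AEMeasurable Ψ (volume.restrict (Ioo 0 t)) :=
      hΨ_meas.mono_measure (Measure.restrict_mono hsub le_rfl)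
    set D : ℝ≥0∞ := ∫⁻ τ in Ioo 0 t, Ψ τ with hD
    have hDtop : D ≠ ∞ := ((lintegral_mono_set hsub).trans_lt hΨT).ne
    have e2 : ∫⁻ τ in Ioo 0 t, L τ ≤ ENNReal.ofReal ν * D + K * ∫⁻ τ in Ioo 0 t, A τ * Φ τ := by
      calc ∫⁻ τ in Ioo 0 t, L τ
          ≤ ∫⁻ τ in Ioo 0 t, (ENNReal.ofReal ν * Ψ τ + K * (A τ * Φ τ)) :=
            lintegral_mono_ae (ae_restrict_of_ae_restrict_of_subset hsub hLbd)
        _ = ENNReal.ofReal ν * D + K * ∫⁻ τ in Ioo 0 t, A τ * Φ τ := by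
            rw [lintegral_add_left' (hΨt_meas.const_mul _),
              lintegral_const_mul' _ _ ENNReal.ofReal_ne_top, lintegral_const_mul' _ _ hK]
    have e1 : Φ t + 2 * ENNReal.ofReal ν * D ≤ 2 * ∫⁻ τ in Ioo 0 t, L τ := H1 t ht
    have e3 : 2 * ENNReal.ofReal ν * D + Φ t ≤
        2 * ENNReal.ofReal ν * D + 2 * K * ∫⁻ τ in Ioo 0 t, A τ * Φ τ := by
      calc 2 * ENNReal.ofReal ν * D + Φ t = Φ t + 2 * ENNReal.ofReal ν * D := add_comm _ _
        _ ≤ 2 * ∫⁻ τ in Ioo 0 t, L τ := e1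
        _ ≤ 2 * (ENNReal.ofReal ν * D + K * ∫⁻ τ in Ioo 0 t, A τ * Φ τ) := by gcongr
        _ = 2 * ENNReal.ofReal ν * D + 2 * K * ∫⁻ τ in Ioo 0 t, A τ * Φ τ := by ring
    exact (ENNReal.add_le_add_iff_left (ENNReal.mul_ne_top
      (ENNReal.mul_ne_top ENNReal.ofNat_ne_top ENNReal.ofReal_ne_top) hDtop)).1 e3
  -- ### boundedness of `‖w(t)‖²` by the energy inequalities
  set M : ℝ≥0∞ := 2 * ENNReal.ofReal (2 * VectorCalculus.kineticEnergy u₀) +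
    2 * ENNReal.ofReal (2 * VectorCalculus.kineticEnergy u₀) with hM
  have hMtop : M ≠ ∞ := ENNReal.add_ne_top.2
    ⟨ENNReal.mul_ne_top ENNReal.ofNat_ne_top ENNReal.ofReal_ne_top,
      ENNReal.mul_ne_top ENNReal.ofNat_ne_top ENNReal.ofReal_ne_top⟩
  have hbound : ∀ t ∈ Ioc 0 T, Φ t ≤ M := by
    intro t ht
    have ht' : t ∈ Icc 0 T := ⟨ht.1.le, ht.2⟩
    have hKEv : FluidPDE.eEnergy (v t) ≤ ENNReal.ofReal (2 * VectorCalculus.kineticEnergy u₀) := by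
      rw [hv.eEnergy_eq ht']
      refine ENNReal.ofReal_le_ofReal (mul_le_mul_of_nonneg_left ?_ zero_le_two)
      exact (le_add_of_nonneg_right (mul_nonneg hν.le ENNReal.toReal_nonneg)).trans (hEv t ht')
    have hKEu : FluidPDE.eEnergy (u t) ≤ ENNReal.ofReal (2 * VectorCalculus.kineticEnergy u₀) := by
      rw [hu.eEnergy_eq ht']
      refine ENNReal.ofReal_le_ofReal (mul_le_mul_of_nonneg_left ?_ zero_le_two)
      exact (le_add_of_nonneg_right (mul_nonneg hν.le ENNReal.toReal_nonneg)).trans (hEu t ht')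
    have hmv : AEMeasurable (fun x => ‖v t x‖ₑ ^ 2) volume :=
      (hv.memLp t ht').aestronglyMeasurable.enorm.pow_const _
    calc Φ t = ∫⁻ x, ‖v t x - u t x‖ₑ ^ 2 := rfl
      _ ≤ ∫⁻ x, (2 * ‖v t x‖ₑ ^ 2 + 2 * ‖u t x‖ₑ ^ 2) := lintegral_mono fun x => enorm_sub_sq_le _ _
      _ = 2 * FluidPDE.eEnergy (v t) + 2 * FluidPDE.eEnergy (u t) := by
          rw [lintegral_add_left' (hmv.const_mul _), lintegral_const_mul' _ _ ENNReal.ofNat_ne_top,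
            lintegral_const_mul' _ _ ENNReal.ofNat_ne_top]
          rfl
      _ ≤ M := by rw [hM]; gcongr
  -- ### integrability of the Gronwall kernel `‖u(t)‖_r^ρ` on `(0, T)`
  have hAT : ∫⁻ t in Ioo 0 T, A t ≠ ∞ := by
    have hvol : volume (Ioo (0 : ℝ) T) ≠ ∞ := by simp
    exact (lintegral_rpow_eLpNorm_lt_top hvol hS hρ0 hρq).ne
  -- ### Gronwall, and conclusion
  intro t ht
  have hΦ0 : Φ t = 0 :=
    lintegral_gronwall_eq_zero (φ := Φ) (a := A) (ENNReal.mul_ne_top ENNReal.ofNat_ne_top hK)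
      hMtop hbound hAT hmain t ht
  have ht' : t ∈ Icc 0 T := ⟨ht.1.le, ht.2⟩
  have hmw : AEMeasurable (fun x => ‖v t x - u t x‖ₑ ^ 2) volume :=
    (hwL2 t ht').aestronglyMeasurable.enorm.pow_const _
  have hae : (fun x => ‖v t x - u t x‖ₑ ^ 2) =ᵐ[volume] 0 := (lintegral_eq_zero_iff' hmw).1 hΦ0
  filter_upwards [hae] with x hx
  simpa [sub_eq_zero] using hx

/-! ### The trilinear estimate from the Sobolev inequality `H¹(ℝ³) ⊂ L⁶(ℝ³)` -/

section Trilinear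

variable {E : Type*} [NormedAddCommGroup E] [InnerProductSpace ℝ E] [FiniteDimensional ℝ E]
variable {F' : Type*} [NormedAddCommGroup F'] [InnerProductSpace ℝ F']

/-- The operator norm is dominated by the Frobenius norm: `‖L v‖ ≤ |L| ‖v‖` with
`|L|² = ∑ᵢ ‖L eᵢ‖²` (expand `v` in the orthonormal frame and use Cauchy–Schwarz). [folklore] -/
theorem norm_apply_le_sqrt_frobeniusNormSq_mul (L : E →L[ℝ] F') (v : E) :
    ‖L v‖ ≤ Real.sqrt (FluidPDE.frobeniusNormSq L) * ‖v‖ := by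
  set b := stdOrthonormalBasis ℝ E with hb
  have hv : L v = ∑ i, ⟪b i, v⟫ • L (b i) := by
    conv_lhs => rw [← b.sum_repr' v]
    simp [map_sum, map_smul]
  have hCS := Finset.sum_mul_sq_le_sq_mul_sq Finset.univ (fun i => |⟪b i, v⟫|) (fun i => ‖L (b i)‖)
  have hpar : ∑ i, |⟪b i, v⟫| ^ 2 = ‖v‖ ^ 2 := by
    rw [← b.sum_sq_norm_inner_right v]
    simp [Real.norm_eq_abs]
  have hfrob : ∑ i, ‖L (b i)‖ ^ 2 = FluidPDE.frobeniusNormSq L := rfl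
  calc ‖L v‖ = ‖∑ i, ⟪b i, v⟫ • L (b i)‖ := by rw [hv]
    _ ≤ ∑ i, ‖⟪b i, v⟫ • L (b i)‖ := norm_sum_le _ _
    _ = ∑ i, |⟪b i, v⟫| * ‖L (b i)‖ := by simp [norm_smul]
    _ ≤ Real.sqrt ((∑ i, |⟪b i, v⟫| ^ 2) * ∑ i, ‖L (b i)‖ ^ 2) :=
        (le_abs_self _).trans (Real.abs_le_sqrt hCS)
    _ = Real.sqrt (FluidPDE.frobeniusNormSq L) * ‖v‖ := by
        rw [hpar, hfrob, mul_comm, Real.sqrt_mul (FluidPDE.frobeniusNormSq_nonneg L),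
          Real.sqrt_sq (norm_nonneg _)]

/-- `ℝ≥0∞` form of `norm_apply_le_sqrt_frobeniusNormSq_mul`:
`‖L v‖ₑ ≤ (ofReal |L|²)^{1/2} ‖v‖ₑ`. [folklore] -/
theorem enorm_apply_le_frobenius_mul (L : E →L[ℝ] F') (v : E) :
    ‖L v‖ₑ ≤ ENNReal.ofReal (FluidPDE.frobeniusNormSq L) ^ (1 / 2 : ℝ) * ‖v‖ₑ := by
  rw [← ofReal_norm, ← ofReal_norm,
    ENNReal.ofReal_rpow_of_nonneg (FluidPDE.frobeniusNormSq_nonneg L) (by norm_num),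
    ← Real.sqrt_eq_rpow, ← ENNReal.ofReal_mul (Real.sqrt_nonneg _)]
  exact ENNReal.ofReal_le_ofReal (norm_apply_le_sqrt_frobeniusNormSq_mul L v)

/-- **Sobolev inequality `‖w‖_{L⁶(ℝ³)} ≤ C ‖∇w‖_{L²(ℝ³)}` for `w ∈ W^{1,2}(ℝ³; ℝ³)`**
(Robinson–Rodrigo–Sadowski 2016, Thm. 1.7 (i): `‖u‖_{L^{p*}} ≤ c‖∇u‖_{L^p}` for `u ∈ W₀^{1,p}`,
`1 ≤ p < n`, `p* = np/(n-p)`, together with `W₀^{1,p}(ℝⁿ) = W^{1,p}(ℝⁿ)` (p. 28); here `n = 3`,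
`p = 2`, `p* = 6`; Evans, *PDE*, §5.6.1, Thm. 1 for the `C¹_c` case, Mathlib's
`MeasureTheory.eLpNorm_le_eLpNorm_fderiv_of_eq`, plus density). Rendering: for `w ∈ L²(ℝ³; ℝ³)`
with weak gradient `G` (accepted `Fluid.HasWeakGradient`), `‖w‖₆ ≤ C (∫ |G|²)^{1/2}` in `ℝ≥0∞`
(trivial when `∫|G|² = ∞`; `|G|²` the Frobenius norm `= ∑ᵢ |∂ᵢw|²`). [cite: RobinsonRodrigoSadowski2016, Thm. 1.7 (i) and W₀^{1,p}(ℝⁿ) = W^{1,p}(ℝⁿ), p. 28] -/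
def sobolev_L6_of_weakGradient_R3 : Prop :=
  ∃ C : ℝ≥0, ∀ (w : EuclideanSpace ℝ (Fin 3) → EuclideanSpace ℝ (Fin 3)) (G : EuclideanSpace ℝ (Fin 3) → EuclideanSpace ℝ (Fin 3) →L[ℝ] EuclideanSpace ℝ (Fin 3)),
    MemLp w 2 volume → FluidPDE.HasWeakGradient w G →
      eLpNorm w 6 volume ≤ C * (∫⁻ x, ENNReal.ofReal (FluidPDE.frobeniusNormSq (G x))) ^ (1 / 2 : ℝ)

/-- **Serrin's trilinear estimate from the Sobolev inequality** (Robinson–Rodrigo–Sadowski 2016,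
proof of Thm. 8.19 / of Lemma 8.18: Hölder with exponents `(s, 2s/(s-2), 2)` (Thm. 1.4), Lebesgue
interpolation `‖w‖_{2s/(s-2)} ≤ ‖w‖₂^{1-3/s}‖w‖₆^{3/s}` (Thm. 1.5) and `‖w‖₆ ≤ c‖∇w‖₂`
(Thm. 1.7)). Real proof: pointwise `|⟪∇w·w, u⟫| ≤ |∇w| |w| |u|` (`enorm_apply_le_frobenius_mul`)
and one four-factor Hölder inequality (Mathlib's `ENNReal.lintegral_prod_norm_pow_le`) with
weights `1/s + (1-θ)/2 + θ/6 + 1/2 = 1`, `θ = 3/s`, which performs Thms. 1.4 and 1.5 at once; then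
`(∫|w|⁶)^{θ/6} = ‖w‖₆^θ ≤ (C‖∇w‖₂)^θ`. The case `s = ∞` is Cauchy–Schwarz after
`|u| ≤ ‖u‖_∞` a.e. [cite: RobinsonRodrigoSadowski2016, proof of Thm. 8.19] -/
theorem serrin_trilinear_estimate_of_sobolev (hSob : sobolev_L6_of_weakGradient_R3) :
    serrin_trilinear_estimate := by
  obtain ⟨C, hC⟩ := hSob
  intro s hs
  have hs0 : s ≠ 0 := by rintro rfl; simp at hs
  -- measurability helpers
  have hGm : ∀ {w : EuclideanSpace ℝ (Fin 3) → EuclideanSpace ℝ (Fin 3)} {G : EuclideanSpace ℝ (Fin 3) → EuclideanSpace ℝ (Fin 3) →L[ℝ] EuclideanSpace ℝ (Fin 3)}, FluidPDE.HasWeakGradient w G →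
      AEMeasurable (fun x => ENNReal.ofReal (FluidPDE.frobeniusNormSq (G x))) volume := by
    intro w G hG
    have hli : LocallyIntegrable G volume := locallyIntegrableOn_univ.1 (by
      simpa only [Opens.coe_top] using hG.locallyIntegrableOn_deriv)
    exact ENNReal.measurable_ofReal.comp_aemeasurable
      (NSWeakStrongUniqueness.continuous_frobeniusNormSq.comp_aestronglyMeasurable hli.aestronglyMeasurable).aemeasurable
  -- pointwise bound of the integrand
  have hpt : ∀ (w u : EuclideanSpace ℝ (Fin 3) → EuclideanSpace ℝ (Fin 3)) (G : EuclideanSpace ℝ (Fin 3) → EuclideanSpace ℝ (Fin 3) →L[ℝ] EuclideanSpace ℝ (Fin 3)) (x : EuclideanSpace ℝ (Fin 3)),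
      ‖⟪G x (w x), u x⟫‖ₑ ≤
        ENNReal.ofReal (FluidPDE.frobeniusNormSq (G x)) ^ (1 / 2 : ℝ) * ‖w x‖ₑ * ‖u x‖ₑ := by
    intro w u G x
    calc ‖⟪G x (w x), u x⟫‖ₑ ≤ ‖G x (w x)‖ₑ * ‖u x‖ₑ := by
          rw [← ofReal_norm, ← ofReal_norm, ← ofReal_norm, ← ENNReal.ofReal_mul (norm_nonneg _)]
          exact ENNReal.ofReal_le_ofReal (norm_inner_le_norm _ _)
      _ ≤ _ := by gcongr; exact enorm_apply_le_frobenius_mul _ _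
  by_cases hstop : s = ∞
  · -- ### the case `s = ∞`: `|u| ≤ ‖u‖_∞` a.e. and Cauchy–Schwarz
    subst hstop
    refine ⟨1, fun w u G hw hG hu => ?_⟩
    simp only [ENNReal.div_top, ENNReal.toReal_zero, sub_zero, add_zero, ENNReal.coe_one, one_mul]
    set f1 : EuclideanSpace ℝ (Fin 3) → ℝ≥0∞ := fun x => ‖w x‖ₑ ^ (2 : ℕ) with hf1
    set f3 : EuclideanSpace ℝ (Fin 3) → ℝ≥0∞ := fun x => ENNReal.ofReal (FluidPDE.frobeniusNormSq (G x)) with hf3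
    have hf1m : AEMeasurable f1 volume := hw.aestronglyMeasurable.enorm.pow_const _
    have hf3m : AEMeasurable f3 volume := hGm hG
    have hutop : eLpNorm u ∞ volume ≠ ∞ := hu.eLpNorm_ne_top
    have hae : ∀ᵐ x ∂volume, ‖⟪G x (w x), u x⟫‖ₑ ≤
        eLpNorm u ∞ volume * (f3 x ^ (1 / 2 : ℝ) * f1 x ^ (1 / 2 : ℝ)) := by
      filter_upwards [ae_le_eLpNormEssSup (f := u) (μ := volume)] with x hx
      rw [← eLpNorm_exponent_top] at hx
      have e1 : ‖w x‖ₑ = f1 x ^ (1 / 2 : ℝ) := by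
        rw [hf1]
        simp only
        rw [← ENNReal.rpow_natCast, ← ENNReal.rpow_mul]
        norm_num
      calc ‖⟪G x (w x), u x⟫‖ₑ ≤ f3 x ^ (1 / 2 : ℝ) * ‖w x‖ₑ * ‖u x‖ₑ := hpt w u G x
        _ ≤ f3 x ^ (1 / 2 : ℝ) * ‖w x‖ₑ * eLpNorm u ∞ volume := by gcongr
        _ = _ := by rw [e1]; ring
    calc ∫⁻ x, ‖⟪G x (w x), u x⟫‖ₑ
        ≤ ∫⁻ x, eLpNorm u ∞ volume * (f3 x ^ (1 / 2 : ℝ) * f1 x ^ (1 / 2 : ℝ)) :=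
          lintegral_mono_ae hae
      _ = eLpNorm u ∞ volume * ∫⁻ x, f3 x ^ (1 / 2 : ℝ) * f1 x ^ (1 / 2 : ℝ) :=
          lintegral_const_mul' _ _ hutop
      _ ≤ eLpNorm u ∞ volume * ((∫⁻ x, f3 x) ^ (1 / 2 : ℝ) * (∫⁻ x, f1 x) ^ (1 / 2 : ℝ)) := by
          gcongr
          exact ENNReal.lintegral_mul_norm_pow_le hf3m hf1m (by norm_num) (by norm_num)
            (by norm_num)
      _ = eLpNorm u ∞ volume * FluidPDE.eEnergy w ^ (1 / 2 : ℝ) * (∫⁻ x, f3 x) ^ (1 / 2 : ℝ) := by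
          rw [FluidPDE.eEnergy]
          ring
  · -- ### the case `3 < s < ∞`
    set σ : ℝ := s.toReal with hσ
    have hσ3 : 3 < σ := by
      have := (ENNReal.toReal_lt_toReal (ENNReal.ofNat_ne_top (n := 3)) hstop).2 hs
      simpa using this
    have hσ0 : 0 < σ := by linarith
    set θ : ℝ := 3 / σ with hθ
    have hθs : ((3 : ℝ≥0∞) / s).toReal = θ := by
      rw [ENNReal.toReal_div, ENNReal.toReal_ofNat]
    have hθ0 : 0 < θ := by positivity
    have hθ1 : θ < 1 := by rw [hθ, div_lt_one hσ0]; exact hσ3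
    refine ⟨C ^ θ, fun w u G hw hG hu => ?_⟩
    rw [hθs, ENNReal.coe_rpow_of_nonneg _ hθ0.le]
    -- the four factors and weights
    set f0 : EuclideanSpace ℝ (Fin 3) → ℝ≥0∞ := fun x => ‖u x‖ₑ ^ σ with hf0
    set f1 : EuclideanSpace ℝ (Fin 3) → ℝ≥0∞ := fun x => ‖w x‖ₑ ^ (2 : ℕ) with hf1
    set f2 : EuclideanSpace ℝ (Fin 3) → ℝ≥0∞ := fun x => ‖w x‖ₑ ^ (6 : ℝ) with hf2
    set f3 : EuclideanSpace ℝ (Fin 3) → ℝ≥0∞ := fun x => ENNReal.ofReal (FluidPDE.frobeniusNormSq (G x)) with hf3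
    have hf0m : AEMeasurable f0 volume := hu.aestronglyMeasurable.enorm.pow_const _
    have hf1m : AEMeasurable f1 volume := hw.aestronglyMeasurable.enorm.pow_const _
    have hf2m : AEMeasurable f2 volume := hw.aestronglyMeasurable.enorm.pow_const _
    have hf3m : AEMeasurable f3 volume := hGm hG
    set F : Fin 4 → EuclideanSpace ℝ (Fin 3) → ℝ≥0∞ := ![f0, f1, f2, f3] with hF
    set P : Fin 4 → ℝ := ![1 / σ, (1 - θ) / 2, θ / 6, 1 / 2] with hP
    have hPsum : ∑ i, P i = 1 := by
      simp only [Fin.sum_univ_four, hP, Matrix.cons_val_zero, Matrix.cons_val_one,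
        Matrix.cons_val, hθ]
      field_simp
      ring
    have hPnn : ∀ i ∈ (Finset.univ : Finset (Fin 4)), 0 ≤ P i := by
      intro i _
      fin_cases i
      · exact div_nonneg zero_le_one hσ0.le
      · exact div_nonneg (by linarith) zero_le_two
      · exact div_nonneg hθ0.le (by norm_num)
      · norm_num [hP]
    have hFm : ∀ i ∈ (Finset.univ : Finset (Fin 4)), AEMeasurable (F i) volume := by
      intro i _
      fin_cases i
      exacts [hf0m, hf1m, hf2m, hf3m]
    have hH := ENNReal.lintegral_prod_norm_pow_le Finset.univ hFm hPsum hPnn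
    simp only [Fin.prod_univ_four] at hH
    -- pointwise: the integrand is dominated by the weighted product
    have hpt' : ∀ x, ‖⟪G x (w x), u x⟫‖ₑ ≤
        F 0 x ^ P 0 * F 1 x ^ P 1 * F 2 x ^ P 2 * F 3 x ^ P 3 := by
      intro x
      have e0 : ‖u x‖ₑ = f0 x ^ (1 / σ) := by
        rw [hf0]
        simp only
        rw [← ENNReal.rpow_mul, mul_one_div_cancel hσ0.ne', ENNReal.rpow_one]
      have e1 : ‖w x‖ₑ = f1 x ^ ((1 - θ) / 2) * f2 x ^ (θ / 6) := by
        rw [hf1, hf2]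
        simp only
        rw [← ENNReal.rpow_natCast, ← ENNReal.rpow_mul, ← ENNReal.rpow_mul,
          ← ENNReal.rpow_add_of_nonneg _ _ (by push_cast; nlinarith) (by positivity)]
        have : ((2 : ℕ) : ℝ) * ((1 - θ) / 2) + 6 * (θ / 6) = 1 := by push_cast; ring
        rw [this, ENNReal.rpow_one]
      calc ‖⟪G x (w x), u x⟫‖ₑ ≤ f3 x ^ (1 / 2 : ℝ) * ‖w x‖ₑ * ‖u x‖ₑ := hpt w u G x
        _ = F 0 x ^ P 0 * F 1 x ^ P 1 * F 2 x ^ P 2 * F 3 x ^ P 3 := by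
            rw [e0, e1]
            simp only [hF, hP, Matrix.cons_val_zero, Matrix.cons_val_one, Matrix.cons_val]
            ring
    -- identify the four integrals
    have i0 : (∫⁻ x, F 0 x) ^ P 0 = eLpNorm u s volume := by
      simp only [hF, hP, Matrix.cons_val_zero]
      rw [eLpNorm_eq_lintegral_rpow_enorm_toReal hs0 hstop]
    have i1 : (∫⁻ x, F 1 x) ^ P 1 = FluidPDE.eEnergy w ^ ((1 - θ) / 2) := by
      simp only [hF, hP, Matrix.cons_val_one, Matrix.cons_val_zero]
      rfl
    have i2 : (∫⁻ x, F 2 x) ^ P 2 ≤ (C : ℝ≥0∞) ^ θ * (∫⁻ x, f3 x) ^ (θ / 2) := by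
      simp only [hF, hP, Matrix.cons_val]
      have h6 : eLpNorm w 6 volume = (∫⁻ x, f2 x) ^ (1 / 6 : ℝ) := by
        rw [eLpNorm_eq_lintegral_rpow_enorm_toReal (by norm_num) (ENNReal.ofNat_ne_top (n := 6))]
        simp [hf2]
      calc (∫⁻ x, f2 x) ^ (θ / 6) = ((∫⁻ x, f2 x) ^ (1 / 6 : ℝ)) ^ θ := by
            rw [← ENNReal.rpow_mul]; ring_nf
        _ ≤ ((C : ℝ≥0∞) * (∫⁻ x, f3 x) ^ (1 / 2 : ℝ)) ^ θ := by
            rw [← h6]; exact ENNReal.rpow_le_rpow (hC w G hw hG) hθ0.le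
        _ = (C : ℝ≥0∞) ^ θ * (∫⁻ x, f3 x) ^ (θ / 2) := by
            rw [ENNReal.mul_rpow_of_nonneg _ _ hθ0.le, ← ENNReal.rpow_mul]; ring_nf
    have i3 : (∫⁻ x, F 3 x) ^ P 3 = (∫⁻ x, f3 x) ^ (1 / 2 : ℝ) := by
      simp only [hF, hP, Matrix.cons_val]
    -- assemble
    calc ∫⁻ x, ‖⟪G x (w x), u x⟫‖ₑ
        ≤ ∫⁻ x, F 0 x ^ P 0 * F 1 x ^ P 1 * F 2 x ^ P 2 * F 3 x ^ P 3 :=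
          lintegral_mono fun x => hpt' x
      _ ≤ (∫⁻ x, F 0 x) ^ P 0 * (∫⁻ x, F 1 x) ^ P 1 * (∫⁻ x, F 2 x) ^ P 2 *
            (∫⁻ x, F 3 x) ^ P 3 := hH
      _ ≤ eLpNorm u s volume * FluidPDE.eEnergy w ^ ((1 - θ) / 2) *
            ((C : ℝ≥0∞) ^ θ * (∫⁻ x, f3 x) ^ (θ / 2)) * (∫⁻ x, f3 x) ^ (1 / 2 : ℝ) := by
          rw [i0, i1, i3]; gcongr
      _ = (C : ℝ≥0∞) ^ θ * eLpNorm u s volume * FluidPDE.eEnergy w ^ ((1 - θ) / 2) *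
            (∫⁻ x, f3 x) ^ ((1 + θ) / 2) := by
          have : (∫⁻ x, f3 x) ^ ((1 + θ) / 2) = (∫⁻ x, f3 x) ^ (θ / 2) * (∫⁻ x, f3 x) ^ (1 / 2 : ℝ) := by
            rw [← ENNReal.rpow_add_of_nonneg _ _ (by positivity) (by norm_num)]; ring_nf
          rw [this]; ring

end Trilinear

end Literature.Analysis.FluidPDE
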